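import Mathlib.MeasureTheory.Integral.IntervalIntegral.Basic
import Literature.MathematicalPhysics.QuantumManyBody.FubiniStudyAngle
import HarnessLib

/-!
# Arc ≥ chord along the impurity coupling path: endpoint near-minimisers from local speed bounds

Topic `Literature/MathematicalPhysics/QuantumManyBody` (companion of `PeriodicBoseGasCouplingPath.lean`
and `FubiniStudyAngle.lean`; wanted by route BECInsertionCorrector, crux `CorrectorClosure`, line
`llp-fidelity-arc`, stub `stub_arcChord`).

Along the coupling path `λ ∈ [0, 1] ↦ H_λ` (`coupledEnergy v λ`), call `Ψ` a `δ`-near-minimiser at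
`λ` if `⟨Ψ, H_λ Ψ⟩ ≤ E_λ + δ`. Suppose that at every node `λ ∈ [0,1]` there is a **local
Fubini–Study speed bound**: for every other node `λ'` within some radius `η(λ)` there is a window
`δ > 0` such that all `δ`-near-minimisers at `λ` and at `λ'` are within Fubini–Study distance
`∫_{[λ ∧ λ', λ ∨ λ']} s` of each other, for one integrable speed `s` on `[0,1]`. Then ONE window
`δ > 0` makes every pair of `δ`-near-minimisers at the endpoints satisfy
`d_FS(Ψ₀, Ψ₁) ≤ ∫_{[0,1]} s` ("the chord is at most the arc", for a path known only through its
near-minimisers) — `fsAngle_endpoints_le_integral_of_local_speed_bound`.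

The proof is the classical continuity/connectedness induction on `[0,1]`
(`exists_window_endpoints_of_local_bound`, stated for an abstract family of predicates
`M λ δ` on a type, a pseudometric `d`, and a primitive `F`): the set of frontiers `c` below which
every node is reachable from `0` within budget `F c - F 0` is an initial segment containing a
neighbourhood of `0`; its supremum `T` is reachable (chain through a reachable node just below `T`,
using the triangle inequality through an auxiliary near-minimiser, which exists because ground-state
energies are infima), and if `T < 1` the local bound at `T` pushes the frontier beyond `T`.
The additivity `∫_{uIcc a b} s = F(a ∨ b) - F(a ∧ b)`, `F c = ∫_0^c s`, is
`setIntegral_uIcc_eq_sub_of_mem_Icc`. This is the metric form of the adiabatic fidelity estimate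
`|⟨Ψ₀(λ), Ψ₀(λ')⟩| = cos d_FS` of [Gu2010, §2].
-/

noncomputable section

open MeasureTheory Filter
open scoped ENNReal NNReal

namespace Literature.MathematicalPhysics.QuantumManyBody.BoseGas

/-! ## The abstract continuity induction on `[0, 1]` -/

section Abstract

variable {S : Type*}

/-- **Chaining local windows along `[0,1]`.** Let `M c δ x` ("`x` is a `δ`-near-minimiser at the
node `c`") be monotone in `δ` and satisfiable for every `δ > 0` at every node of `[0,1]`, let `d` be a
symmetric function on `S` satisfying the triangle inequality, and let `F : ℝ → ℝ`. If every node
`c ∈ [0,1]` has a radius `η > 0` such that for every other node `c'` within `η` some window `δ > 0`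
forces `d x x' ≤ F (c ∨ c') - F (c ∧ c')` for all `δ`-near-minimisers `x` at `c`, `x'` at `c'`, then
one window `δ > 0` forces `d x₀ x₁ ≤ F 1 - F 0` for all `δ`-near-minimisers at the endpoints.
[folklore] -/
theorem exists_window_endpoints_of_local_bound {M : ℝ → ℝ≥0∞ → S → Prop} {d : S → S → ℝ}
    {F : ℝ → ℝ} (hmono : ∀ c δ δ' x, δ ≤ δ' → M c δ x → M c δ' x)
    (hex : ∀ c ∈ Set.Icc (0 : ℝ) 1, ∀ δ : ℝ≥0∞, 0 < δ → ∃ x, M c δ x)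
    (htri : ∀ x y z, d x z ≤ d x y + d y z) (hsymm : ∀ x y, d x y = d y x)
    (hloc : ∀ c ∈ Set.Icc (0 : ℝ) 1, ∃ η : ℝ, 0 < η ∧ ∀ c' ∈ Set.Icc (0 : ℝ) 1, c' ≠ c →
      |c' - c| < η → ∃ δ : ℝ≥0∞, 0 < δ ∧ ∀ x x', M c δ x → M c' δ x' →
        d x x' ≤ F (max c c') - F (min c c')) :
    ∃ δ : ℝ≥0∞, 0 < δ ∧ ∀ x₀ x₁, M 0 δ x₀ → M 1 δ x₁ → d x₀ x₁ ≤ F 1 - F 0 := by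
  -- reachability of a node `c` from `0` within budget `F c - F 0`
  obtain ⟨P, hP⟩ : ∃ P : ℝ → Prop, ∀ c, P c ↔
      ∃ δ : ℝ≥0∞, 0 < δ ∧ ∀ x₀ x, M 0 δ x₀ → M c δ x → d x₀ x ≤ F c - F 0 :=
    ⟨_, fun _ => Iff.rfl⟩
  -- extension of reachability along a link `a → b`
  have hext : ∀ a ∈ Set.Icc (0 : ℝ) 1, ∀ b, P a →
      (∃ δ : ℝ≥0∞, 0 < δ ∧ ∀ x x', M a δ x → M b δ x' → d x x' ≤ F b - F a) → P b := by
    rintro a ha b hPa ⟨δ₂, hδ₂, h₂⟩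
    obtain ⟨δ₁, hδ₁, h₁⟩ := (hP a).1 hPa
    refine (hP b).2 ⟨min δ₁ δ₂, lt_min hδ₁ hδ₂, fun x₀ x hx₀ hx => ?_⟩
    obtain ⟨y, hy⟩ := hex a ha (min δ₁ δ₂) (lt_min hδ₁ hδ₂)
    have h1 := h₁ x₀ y (hmono _ _ _ _ (min_le_left _ _) hx₀) (hmono _ _ _ _ (min_le_left _ _) hy)
    have h2 := h₂ y x (hmono _ _ _ _ (min_le_right _ _) hy) (hmono _ _ _ _ (min_le_right _ _) hx)
    linarith [htri x₀ y x]
  -- a neighbourhood of `0` is reachable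
  obtain ⟨η₀, hη₀, h₀⟩ := hloc 0 ⟨le_rfl, zero_le_one⟩
  have hstart : ∀ c ∈ Set.Icc (0 : ℝ) 1, 0 < c → c < η₀ → P c := by
    intro c hc hc0 hcη
    obtain ⟨δ, hδ, h⟩ := h₀ c hc hc0.ne' (by rwa [sub_zero, abs_of_pos hc0])
    refine (hP c).2 ⟨δ, hδ, fun x₀ x hx₀ hx => ?_⟩
    have := h x₀ x hx₀ hx
    rwa [max_eq_right hc.1, min_eq_left hc.1] at this
  -- the frontier set and its supremum
  set A : Set ℝ := {c | c ∈ Set.Icc (0 : ℝ) 1 ∧ ∀ c'' ∈ Set.Ioc (0 : ℝ) c, P c''} with hA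
  have h0A : (0 : ℝ) ∈ A := ⟨⟨le_rfl, zero_le_one⟩, fun c'' hc'' => absurd hc''.2 (not_le.2 hc''.1)⟩
  have hAne : A.Nonempty := ⟨0, h0A⟩
  have hAbdd : BddAbove A := ⟨1, fun c hc => hc.1.2⟩
  set T : ℝ := sSup A with hT
  have hT1 : T ≤ 1 := csSup_le hAne fun c hc => hc.1.2
  have hT0 : 0 < T := by
    have hc₁A : min (η₀ / 2) 1 ∈ A := by
      refine ⟨⟨le_min (by positivity) zero_le_one, min_le_right _ _⟩, fun c'' hc'' => ?_⟩
      exact hstart c'' ⟨hc''.1.le, hc''.2.trans (min_le_right _ _)⟩ hc''.1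
        ((hc''.2.trans (min_le_left _ _)).trans_lt (by linarith))
    exact (lt_min (by positivity) zero_lt_one).trans_le (le_csSup hAbdd hc₁A)
  -- every node strictly below the frontier is reachable
  have hbelow : ∀ c, 0 < c → c < T → P c := by
    intro c hc hcT
    obtain ⟨a, ha, hca⟩ := exists_lt_of_lt_csSup hAne hcT
    exact ha.2 c ⟨hc, hca.le⟩
  -- the frontier itself is reachable
  obtain ⟨η, hη, hηT⟩ := hloc T ⟨hT0.le, hT1⟩
  have hPT : P T := by
    set c : ℝ := max (T - η / 2) (T / 2) with hc
    have hc0 : 0 < c := (half_pos hT0).trans_le (le_max_right _ _)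
    have hcT : c < T := max_lt (by linarith) (half_lt_self hT0)
    have hcη : |c - T| < η := by
      rw [abs_sub_comm, abs_of_pos (sub_pos.2 hcT)]
      have : T - η / 2 ≤ c := le_max_left _ _
      linarith
    have hc01 : c ∈ Set.Icc (0 : ℝ) 1 := ⟨hc0.le, hcT.le.trans hT1⟩
    obtain ⟨δ, hδ, h⟩ := hηT c hc01 hcT.ne hcη
    refine hext c hc01 T (hbelow c hc0 hcT) ⟨δ, hδ, fun x x' hx hx' => ?_⟩
    have := h x' x hx' hx
    rwa [max_eq_left hcT.le, min_eq_right hcT.le, hsymm] at this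
  -- the frontier is `1`
  have hT_eq : T = 1 := by
    by_contra hne
    have hT1' : T < 1 := lt_of_le_of_ne hT1 hne
    have habove : ∀ c' ∈ Set.Icc (0 : ℝ) 1, T < c' → c' < T + η → P c' := by
      intro c' hc' hTc' hc'η
      obtain ⟨δ, hδ, h⟩ := hηT c' hc' hTc'.ne' (by rw [abs_of_pos (sub_pos.2 hTc')]; linarith)
      refine hext T ⟨hT0.le, hT1⟩ c' hPT ⟨δ, hδ, fun x x' hx hx' => ?_⟩
      have := h x x' hx hx'
      rwa [max_eq_right hTc'.le, min_eq_left hTc'.le] at this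
    have hc₂A : min (T + η / 2) 1 ∈ A := by
      refine ⟨⟨le_min (by linarith) zero_le_one, min_le_right _ _⟩, fun c'' hc'' => ?_⟩
      rcases lt_trichotomy c'' T with hlt | heq | hgt
      · exact hbelow c'' hc''.1 hlt
      · exact heq ▸ hPT
      · exact habove c'' ⟨hc''.1.le, hc''.2.trans (min_le_right _ _)⟩ hgt
          ((hc''.2.trans (min_le_left _ _)).trans_lt (by linarith))
    have := le_csSup hAbdd hc₂A
    exact absurd this (not_le.2 (lt_min (by linarith) hT1'))
  -- conclusion
  rw [hT_eq] at hPT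
  exact (hP 1).1 hPT

end Abstract

/-! ## Budgets over unordered intervals -/

/-- For a speed `s` integrable on `[0,1]` and nodes `a, b ∈ [0,1]`, the budget over the unordered
interval is a difference of primitives: `∫_{uIcc a b} s = ∫_0^{a ∨ b} s - ∫_0^{a ∧ b} s`. [folklore] -/
theorem setIntegral_uIcc_eq_sub_of_mem_Icc {s : ℝ → ℝ} (hs : IntegrableOn s (Set.Icc (0 : ℝ) 1))
    {a b : ℝ} (ha : a ∈ Set.Icc (0 : ℝ) 1) (hb : b ∈ Set.Icc (0 : ℝ) 1) :
    ∫ t in Set.uIcc a b, s t = (∫ t in (0 : ℝ)..max a b, s t) - ∫ t in (0 : ℝ)..min a b, s t := by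
  wlog hab : a ≤ b generalizing a b
  · rw [Set.uIcc_comm, max_comm, min_comm]
    exact this hb ha (le_of_not_ge hab)
  rw [Set.uIcc_of_le hab, max_eq_right hab, min_eq_left hab]
  have hint : ∀ c ∈ Set.Icc (0 : ℝ) 1, IntervalIntegrable s volume 0 c := fun c hc =>
    (hs.mono_set (by rw [Set.uIcc_of_le hc.1]; exact Set.Icc_subset_Icc_right hc.2)).intervalIntegrable
  rw [intervalIntegral.integral_interval_sub_left (hint b hb) (hint a ha),
    intervalIntegral.integral_of_le hab, integral_Icc_eq_integral_Ioc]

/-- The total budget: `∫_0^1 s - ∫_0^0 s = ∫_{[0,1]} s`. [folklore] -/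
theorem intervalIntegral_one_sub_zero (s : ℝ → ℝ) :
    (∫ t in (0 : ℝ)..1, s t) - (∫ t in (0 : ℝ)..0, s t) = ∫ t in Set.Icc (0 : ℝ) 1, s t := by
  rw [intervalIntegral.integral_same, sub_zero, intervalIntegral.integral_of_le zero_le_one,
    integral_Icc_eq_integral_Ioc]

/-! ## Arc ≥ chord for near-minimisers of the coupling path -/

variable {N : ℕ} {L : ℝ}

/-- Near-minimisers exist at every window `δ > 0` (ground-state energies are infima), as soon as
there is at least one tagged state. [folklore] -/
theorem exists_nearMinimiser_coupledEnergy [Nonempty (TaggedPeriodicTrialState N L)]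
    (v : ℝ → ℝ≥0∞) (lam : ℝ) {δ : ℝ≥0∞} (hδ : 0 < δ) :
    ∃ Ψ : TaggedPeriodicTrialState N L,
      coupledEnergy v lam Ψ ≤ coupledGroundStateEnergy v lam N L + δ := by
  rcases eq_or_ne (coupledGroundStateEnergy v lam N L) ⊤ with htop | hfin
  · exact ⟨Classical.arbitrary _, by rw [htop, top_add]; exact le_top⟩
  · have h : (⨅ Ψ : TaggedPeriodicTrialState N L, coupledEnergy v lam Ψ) <
        coupledGroundStateEnergy v lam N L + δ := ENNReal.lt_add_right hfin hδ.ne'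
    obtain ⟨Ψ, hΨ⟩ := iInf_lt_iff.mp h
    exact ⟨Ψ, hΨ.le⟩

/-- **Arc ≥ chord for near-minimisers of the coupling path.** If at every node `λ ∈ [0,1]` of the
coupling path there is a local Fubini–Study speed bound — for every other node `λ'` within some
radius there is a window `δ > 0` such that all `δ`-near-minimisers of `H_λ` and of `H_{λ'}` are within
`d_FS ≤ ∫_{uIcc λ λ'} s` — for one speed `s` integrable on `[0,1]`, then one window `δ > 0` makes every
`δ`-near-minimiser `Ψ₀` of `H₀` and every `δ`-near-minimiser `Ψ₁` of `H₁` satisfy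
`d_FS(Ψ₀, Ψ₁) ≤ ∫_{[0,1]} s`.
[cite: Gu2010, §2 (ground-state fidelity as cos of the Fubini–Study distance along a parameter path)] -/
theorem fsAngle_endpoints_le_integral_of_local_speed_bound (v : ℝ → ℝ≥0∞) (N : ℕ) (L : ℝ)
    (s : ℝ → ℝ) (hs : IntegrableOn s (Set.Icc (0 : ℝ) 1))
    (hloc : ∀ lam ∈ Set.Icc (0 : ℝ) 1,
      ∃ η : ℝ, 0 < η ∧ ∀ lam' ∈ Set.Icc (0 : ℝ) 1, lam' ≠ lam → |lam' - lam| < η →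
        ∃ δ : ℝ≥0∞, 0 < δ ∧ ∀ Ψ Ψ' : TaggedPeriodicTrialState N L,
          coupledEnergy v lam Ψ ≤ coupledGroundStateEnergy v lam N L + δ →
          coupledEnergy v lam' Ψ' ≤ coupledGroundStateEnergy v lam' N L + δ →
            fsAngle Ψ Ψ' ≤ ∫ t in Set.uIcc lam lam', s t) :
    ∃ δ : ℝ≥0∞, 0 < δ ∧ ∀ Ψ₀ Ψ₁ : TaggedPeriodicTrialState N L,
      coupledEnergy v 0 Ψ₀ ≤ coupledGroundStateEnergy v 0 N L + δ →
      coupledEnergy v 1 Ψ₁ ≤ coupledGroundStateEnergy v 1 N L + δ →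
        fsAngle Ψ₀ Ψ₁ ≤ ∫ t in Set.Icc (0 : ℝ) 1, s t := by
  rcases isEmpty_or_nonempty (TaggedPeriodicTrialState N L) with hE | hne
  · exact ⟨1, one_pos, fun Ψ₀ => isEmptyElim Ψ₀⟩
  rw [← intervalIntegral_one_sub_zero s]
  refine exists_window_endpoints_of_local_bound
    (M := fun c δ (Ψ : TaggedPeriodicTrialState N L) =>
      coupledEnergy v c Ψ ≤ coupledGroundStateEnergy v c N L + δ)
    (d := fsAngle) (F := fun c => ∫ t in (0 : ℝ)..c, s t)
    (fun c δ δ' Ψ hδ h => h.trans (by gcongr))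
    (fun c _ δ hδ => exists_nearMinimiser_coupledEnergy v c hδ)
    fsAngle_triangle fsAngle_comm fun c hc => ?_
  obtain ⟨η, hη, h⟩ := hloc c hc
  refine ⟨η, hη, fun c' hc' hne hlt => ?_⟩
  obtain ⟨δ, hδ, h'⟩ := h c' hc' hne hlt
  refine ⟨δ, hδ, fun Ψ Ψ' hΨ hΨ' => ?_⟩
  rw [← setIntegral_uIcc_eq_sub_of_mem_Icc hs hc hc']
  exact h' Ψ Ψ' hΨ hΨ'

end Literature.MathematicalPhysics.QuantumManyBody.BoseGas

end
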